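import Summits.QuantumAdvantage.QuantumAdvantage.Theorems.CharDialSubCharCombinatorics
import HarnessLib

/-!
# MultiRamsey — the k-uniform hypergraph Ramsey theorem with finitely many colours

(decomp-qadv-lens-6 g8; PLAN-g9.md §11.1.)  From the two-colour `SubChar.ramsey` (g7, `SubCharCombinatorics`) by
induction on the number of colours: split "colour `= c₀`" against "colour `≠ c₀`"; a large set homogeneous for the
second class carries one colour fewer.  `SubChar.ramsey_finite_colours κ k M`: every colouring of the `k`-subsets of a
large enough finite set by a finite type `κ` has an `M`-set all of whose `k`-subsets get the same colour.
-/

namespace Summit.QuantumAdvantage.AdviceFreeQNC0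

namespace SubChar

open Finset

/-- Multicolour `k`-uniform Ramsey, colours confined to a set `C` of at most `c` colours (induction on `c`). -/
theorem ramsey_multicolour (k M : ℕ) : ∀ c : ℕ, ∃ N : ℕ, ∀ (α : Type) [DecidableEq α] (V : Finset α)
    (κ : Type) [DecidableEq κ] (col : Finset α → κ) (C : Finset κ), C.card ≤ c →
    (∀ T ⊆ V, T.card = k → col T ∈ C) → N ≤ V.card →
    ∃ X ⊆ V, M ≤ X.card ∧ ∃ γ : κ, ∀ T ⊆ X, T.card = k → col T = γ := by
  intro c
  induction c with
  | zero =>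
    refine ⟨k, fun α _ V κ _ col C hC hcol hV => ?_⟩
    exfalso
    obtain ⟨T, hTV, hT⟩ := Finset.exists_subset_card_eq hV
    have hmem := hcol T hTV hT
    rw [Finset.card_eq_zero.1 (Nat.le_zero.1 hC)] at hmem
    exact absurd hmem (Finset.notMem_empty _)
  | succ c ih =>
    obtain ⟨N', hN'⟩ := ih
    obtain ⟨R, hR⟩ := ramsey k M N'
    refine ⟨max R k, fun α _ V κ _ col C hC hcol hV => ?_⟩
    by_cases hCe : C = ∅
    · exfalso
      obtain ⟨T, hTV, hT⟩ := Finset.exists_subset_card_eq (le_trans (le_max_right _ _) hV)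
      have hmem := hcol T hTV hT
      rw [hCe] at hmem
      exact absurd hmem (Finset.notMem_empty _)
    · obtain ⟨c₀, hc₀⟩ := Finset.nonempty_iff_ne_empty.2 hCe
      rcases hR α V (fun T => decide (col T = c₀)) (le_trans (le_max_left _ _) hV) with
        ⟨S, hSV, hMS, hS⟩ | ⟨S, hSV, hN'S, hS⟩
      · exact ⟨S, hSV, hMS, c₀, fun T hT hTk => of_decide_eq_true (hS T hT hTk)⟩
      · have hC' : (C.erase c₀).card ≤ c := by
          rw [Finset.card_erase_of_mem hc₀]
          omega
        obtain ⟨X, hXS, hMX, γ, hγ⟩ := hN' α S κ col (C.erase c₀) hC'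
          (fun T hT hTk => Finset.mem_erase.2 ⟨of_decide_eq_false (hS T hT hTk), hcol T (hT.trans hSV) hTk⟩) hN'S
        exact ⟨X, hXS.trans hSV, hMX, γ, hγ⟩

/-- **Hypergraph Ramsey with finitely many colours**: for a finite colour type `κ` and all `k, M` there is `N` such that
every `κ`-colouring of the `k`-subsets of a finite set with at least `N` elements admits an `M`-subset all of whose
`k`-subsets have the same colour. -/
theorem ramsey_finite_colours (κ : Type) [Fintype κ] (k M : ℕ) :
    ∃ N : ℕ, ∀ (α : Type) [DecidableEq α] (V : Finset α), N ≤ V.card → ∀ col : Finset α → κ,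
      ∃ X ⊆ V, M ≤ X.card ∧ ∃ γ : κ, ∀ T ⊆ X, T.card = k → col T = γ := by
  classical
  obtain ⟨N, hN⟩ := ramsey_multicolour k M (Fintype.card κ)
  exact ⟨N, fun α _ V hV col =>
    hN α V κ col Finset.univ (Finset.card_univ (α := κ)).le (fun T _ _ => Finset.mem_univ _) hV⟩

end SubChar

end Summit.QuantumAdvantage.AdviceFreeQNC0
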